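import Literature.Geometry.Lorentzian.WeightedNorms
import Literature.Geometry.Lorentzian.InitialDataPullback
import Literature.Geometry.Lorentzian.KerrData
import Literature.Geometry.Lorentzian.KerrSliceFacts
import Literature.Geometry.Lorentzian.Hypersurface
import Literature.Geometry.Lorentzian.ChartSecondFundamentalForm
import Summits.FinalStateConjecture.FinalStateConjecture.Theorems.KerrShieldedDataExist.Negative.SliceClause
import HarnessLib

/-!
# Crux `PhaseMixingCapture.CaptureSufficesC2` (stmt-FinalStateConjecture-14986), line `Sketch`,
# stub `stub_softOfExactShield` — EXACT shields at the mass junction are ε-SOFT C2 shields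

Registered Stub 1b (v5 skeleton), proved: a datum which outside a compact set IS the bent
Kerr–Schild slice datum of Kerr `(M, a)` on `Kerr.slice a M = {t* = 0, r > M}` (shield map `φ`,
bent graph `ψ`, future unit normal `ν`, pull-back clauses at EVERY point) is `ε`-softly shielded
for every `(s, δ)`, `ε > 0`, with the SAME witnesses. On the open collar `{M < r < 4M}` the bent
height vanishes (`bentHeight_eq_zero_of_le`), so `ψ` coincides near every collar point with the
slice embedding `y ↦ (0, y)`; by UNIQUENESS OF THE FUTURE UNIT NORMAL of the spacelike slice
(`eq_smul_of_unit_future_normal`, O'Neill 1983, Ch. 5, Lemma 5.26; Cook 2000, §3.2.2) `ν`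
coincides there with `Kerr.sliceNormal`; by LOCALITY of the pull-back and of the second fundamental
form (`OpensChart.secondFundamentalForm_eq_of_repr` only consumes first-order germs of the
representatives) the pulled-back `(h, k)` ARE the slice data `Kerr.data M a M` on the collar, so
both collar differences vanish and all their weighted Sobolev seminorms over the (open) collar are
`0` — clauses (i), (iii); clauses (ii) (`r ≥ 3M`) are the hypothesis. No `sorry`, no named facts.

References: Cook, Living Rev. Relativ. 3 (2000) 5, §3.2.2, (55)–(57); O'Neill 1983, Ch. 4,
Lemma 4.1/4.4, Ch. 5, Lemma 5.26; Dafermos–Rodnianski arXiv:0811.0354, §5.1; Bartnik 1986, (1.2).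
-/

set_option linter.dupNamespace false

noncomputable section

open Set Filter Function Topology TopologicalSpace MeasureTheory
open scoped Manifold ContDiff Topology

namespace Summit.FinalStateConjecture.FinalStateConjecture.Theorems.CaptureSufficesC2.Sketch

open Literature.Geometry.Lorentzian
open Summit.FinalStateConjecture.FinalStateConjecture.Theorems.KerrShieldedDataExist.Negative
  (bentHeight bentHeight_eq_zero_of_le)

namespace SoftOfExactShield

section Analytic

variable {F G : Type*} [NormedAddCommGroup F] [NormedSpace ℝ F] [NormedAddCommGroup G]
  [NormedSpace ℝ G]

/-- Derivatives of a function vanishing on an open set vanish there. [folklore] -/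
theorem iteratedFDeriv_eq_zero_of_eqOn {U : Set F} (hU : IsOpen U) {f : F → G} (hf : EqOn f 0 U)
    {x : F} (hx : x ∈ U) (m : ℕ) : iteratedFDeriv ℝ m f x = 0 := by
  have hfx : f =ᶠ[𝓝 x] (0 : F → G) := hf.eventuallyEq_of_mem (hU.mem_nhds hx)
  rw [(hfx.iteratedFDeriv ℝ m).eq_of_nhds]
  simp

variable [MeasureSpace F] [OpensMeasurableSpace F]

/-- The weighted Sobolev seminorm over an OPEN set of a function vanishing there is `0`. [folklore] -/
theorem weightedSobolevSeminorm_eq_zero_of_eqOn {U : Set F} (hU : IsOpen U) (s : ℕ) (δ : ℝ)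
    {f : F → G} (hf : EqOn f 0 U) : weightedSobolevSeminorm U s δ f = 0 := by
  unfold weightedSobolevSeminorm
  have hint : ∀ m ∈ Finset.range (s + 1),
      ∫⁻ x in U, ENNReal.ofReal ((1 + ‖x‖) ^ (2 * (δ + m) : ℝ) * ‖iteratedFDeriv ℝ m f x‖ ^ 2) = 0 := by
    intro m _
    refine (setLIntegral_congr_fun hU.measurableSet ?_).trans lintegral_zero
    intro x hx
    simp only [iteratedFDeriv_eq_zero_of_eqOn hU hf hx m, norm_zero]
    simp
  rw [Finset.sum_eq_zero hint]
  simp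

/-- Clauses (i) and (iii) of the soft shield from VANISHING collar differences (lead's
`S1bScratch`): `ε`-closeness and all-orders finiteness. [folklore] -/
theorem collar_clauses_of_eqOn_zero {U : Set F} (hU : IsOpen U) {fh fk : F → G} (hfh : EqOn fh 0 U)
    (hfk : EqOn fk 0 U) {ε : ℝ} (hε : 0 < ε) (s : ℕ) (δ : ℝ) :
    weightedSobolevSeminorm U s δ fh + weightedSobolevSeminorm U (s - 1) (δ + 1) fk <
        ENNReal.ofReal ε ∧
      ∀ s' : ℕ, weightedSobolevSeminorm U s' δ fh +
        weightedSobolevSeminorm U (s' - 1) (δ + 1) fk < ⊤ := by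
  refine ⟨?_, fun s' ↦ ?_⟩
  · rw [weightedSobolevSeminorm_eq_zero_of_eqOn hU s δ hfh,
      weightedSobolevSeminorm_eq_zero_of_eqOn hU (s - 1) (δ + 1) hfk, add_zero]
    exact ENNReal.ofReal_pos.2 hε
  · rw [weightedSobolevSeminorm_eq_zero_of_eqOn hU s' δ hfh,
      weightedSobolevSeminorm_eq_zero_of_eqOn hU (s' - 1) (δ + 1) hfk, add_zero]
    exact ENNReal.zero_lt_top

end Analytic

/-- **Uniqueness of the future unit normal, abstract form**: if `b(V, ·) = −dx⁰`, `b(V, V) = −c < 0`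
and `b((0,u),(0,u)) ≥ ‖u‖²`, then `n ⊥_b (0, E3)`, `b(n, n) = −1`, `b(V, n) < 0` force
`n = c^{-1/2} V` (write `n = αV + (0, u)`; then `b((0,u),(0,u)) = 0`, so `u = 0`; unit length and
the time cone pin `α`). O'Neill 1983, Ch. 5, Lemma 5.26. [cite: ONeill1983, Ch. 5, Lemma 5.26] -/
theorem eq_smul_of_unit_future_normal {b : E4 →L[ℝ] E4 →L[ℝ] ℝ} {V n : E4} {c : ℝ} (hc : 0 < c)
    (hV1 : ∀ w : E4, b V w = -w 0) (hV2 : b V V = -c)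
    (hpos : ∀ u : E3, ‖u‖ ^ 2 ≤ b (E4.ofTimeSpace 0 u) (E4.ofTimeSpace 0 u))
    (hn : ∀ w : E3, b n (E4.ofTimeSpace 0 w) = 0) (hu : b n n = -1) (hf : b V n < 0) :
    n = (√c)⁻¹ • V := by
  have hV0 : V 0 = c := by have := hV1 V; rw [hV2] at this; linarith
  set α : ℝ := n 0 / c with hαdef
  set B : E4 := n - α • V with hBdef
  have hB0 : B 0 = 0 := by
    simp only [hBdef, PiLp.sub_apply, PiLp.smul_apply, smul_eq_mul, hV0, hαdef]
    field_simp; ring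
  have hB : E4.ofTimeSpace 0 (E4.spatial B) = B := by
    have := E4.ofTimeSpace_time_spatial B
    rwa [E4.time_apply, hB0] at this
  have hnB : b n B = 0 := by rw [← hB]; exact hn _
  have hVB : b V B = 0 := by rw [hV1, hB0, neg_zero]
  have hBB : b B B = 0 := by
    have e : b (n - α • V) B = 0 := by
      have h1 : b (n - α • V) B = b n B - α * b V B := by simp only [map_sub, map_smul]; rfl
      rw [h1, hnB, hVB]; ring
    rwa [← hBdef] at e
  have hsB : E4.spatial B = 0 := by
    have h1 := hpos (E4.spatial B)
    rw [hB, hBB] at h1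
    have h3 : ‖E4.spatial B‖ ^ 2 = 0 := le_antisymm h1 (sq_nonneg _)
    exact norm_eq_zero.1 (pow_eq_zero_iff two_ne_zero |>.1 h3)
  have hBzero : B = 0 := by rw [← hB, hsB]; exact map_zero E4.spaceEmbed
  have hnV : n = α • V := sub_eq_zero.1 hBzero
  have hαα : b (α • V) (α • V) = α * (α * b V V) := by simp only [map_smul]; rfl
  have hVα : b V (α • V) = α * b V V := by simp only [map_smul]; rfl
  have hαsq : α ^ 2 * c = 1 := by
    rw [hnV, hαα, hV2] at hu
    nlinarith [hu]
  have hαpos : 0 < α := by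
    rw [hnV, hVα, hV2] at hf
    nlinarith [hf, hc]
  have hα : α = (√c)⁻¹ := by
    rw [← Real.sqrt_inv]
    have : c⁻¹ = α ^ 2 := by rw [eq_comm, ← one_div, eq_div_iff hc.ne']; exact hαsq
    rw [this, Real.sqrt_sq hαpos.le]
  rw [hnV, hα]

/-- **Uniqueness of the future unit normal of `{t* = const}` in Kerr `(M, a)`**, `M ≥ 0`, `r > 0`:
`n ⊥_g (0, E3)`, `g(n, n) = −1`, `g(V, n) < 0` (`V = −g♯dt*`) force `n = (1 + 2H)^{-1/2} V`, the
value of `Kerr.sliceNormal` (general-spin `Kerr.eq_sliceNormalRep`; `g((0,u),(0,u)) =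
‖u‖² + 2H(ℓ⃗·u)²`, Cook 2000, (55)). O'Neill 1983, Ch. 5, Lemma 5.26. [cite: Cook2000, §3.2.2] -/
theorem eq_sliceNormalRep_of_normal {M a : ℝ} (hM : 0 ≤ M) {x : E4} (hx : 0 < Kerr.radius a x)
    {n : E4} (hn : ∀ w : E3, Kerr.bilin M a x n (E4.ofTimeSpace 0 w) = 0)
    (hu : Kerr.bilin M a x n n = -1)
    (hf : Kerr.bilin M a x (Kerr.timeVector M a x) n < 0) :
    n = (√(1 + 2 * Kerr.scalarH M a x))⁻¹ • Kerr.timeVector M a x := by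
  have hH := Kerr.scalarH_nonneg hM a x
  have hc : 0 < 1 + 2 * Kerr.scalarH M a x := by linarith
  refine eq_smul_of_unit_future_normal hc (Kerr.bilin_timeVector hx) ?_ (fun u ↦ ?_) hn hu hf
  · rw [Kerr.bilin_timeVector_timeVector hx]; ring
  · have h := Kerr.bilin_spaceEmbed_spaceEmbed M a x u
    rw [E4.spaceEmbed_apply] at h
    exact h ▸ le_add_of_nonneg_right (mul_nonneg (mul_nonneg zero_le_two hH) (sq_nonneg _))

section Unbent

variable {M a r₁ : ℝ}

/-- `y ↦ r(a, (0, y))` is continuous on `E3`. [folklore] -/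
theorem continuous_radius_ofTimeSpace (a : ℝ) :
    Continuous fun z : E3 ↦ Kerr.radius a (E4.ofTimeSpace 0 z) :=
  (Kerr.continuous_radius a).comp (E4.continuous_ofTimeSpace 0)

/-- Below `4M` the representative `z ↦ (T(r(0,z)), z)` of the bent graph is `z ↦ (0, z)` NEAR `z`. [folklore] -/
theorem bentRep_eventuallyEq (hM0 : 0 < M) {z : E3}
    (hz : Kerr.radius a (E4.ofTimeSpace 0 z) < 4 * M) :
    (fun u : E3 ↦ E4.ofTimeSpace (bentHeight M a (Kerr.radius a (E4.ofTimeSpace 0 u))) u) =ᶠ[𝓝 z]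
      E4.ofTimeSpace 0 := by
  have hev : ∀ᶠ u : E3 in 𝓝 z, Kerr.radius a (E4.ofTimeSpace 0 u) < 4 * M :=
    (isOpen_lt (continuous_radius_ofTimeSpace a) continuous_const).mem_nhds hz
  filter_upwards [hev] with u hu
  rw [bentHeight_eq_zero_of_le hM0 hu.le]

variable {ψ : Kerr.slice a r₁ → Kerr.region a r₁}

/-- Below `4M` the bent graph `ψ` IS the slice embedding `y ↦ (0, y)`. [folklore] -/
theorem psi_eq_sliceEmbed (hM0 : 0 < M)
    (hψ : ∀ y : Kerr.slice a r₁, (ψ y : E4) =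
      E4.ofTimeSpace (bentHeight M a (Kerr.radius a (E4.ofTimeSpace 0 (y : E3)))) (y : E3))
    {y : Kerr.slice a r₁} (hy : Kerr.radius a (E4.ofTimeSpace 0 (y : E3)) < 4 * M) :
    ψ y = Kerr.sliceEmbed a r₁ y := by
  apply Subtype.ext
  rw [hψ y, Kerr.coe_sliceEmbed, bentHeight_eq_zero_of_le hM0 hy.le]

/-- … and it coincides with the slice embedding NEAR such a point. [folklore] -/
theorem psi_eventuallyEq_sliceEmbed (hM0 : 0 < M)
    (hψ : ∀ y : Kerr.slice a r₁, (ψ y : E4) =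
      E4.ofTimeSpace (bentHeight M a (Kerr.radius a (E4.ofTimeSpace 0 (y : E3)))) (y : E3))
    {y : Kerr.slice a r₁} (hy : Kerr.radius a (E4.ofTimeSpace 0 (y : E3)) < 4 * M) :
    ψ =ᶠ[𝓝 y] Kerr.sliceEmbed a r₁ := by
  have hc : Continuous fun z : Kerr.slice a r₁ ↦ Kerr.radius a (E4.ofTimeSpace 0 (z : E3)) :=
    (continuous_radius_ofTimeSpace a).comp continuous_subtype_val
  have hev : ∀ᶠ z : Kerr.slice a r₁ in 𝓝 y, Kerr.radius a (E4.ofTimeSpace 0 (z : E3)) < 4 * M :=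
    (isOpen_lt hc continuous_const).mem_nhds hy
  filter_upwards [hev] with z hz
  exact psi_eq_sliceEmbed hM0 hψ hz

/-- … so its differential there is `v ↦ (0, v)`. [folklore] -/
theorem mfderiv_psi (hM0 : 0 < M)
    (hψ : ∀ y : Kerr.slice a r₁, (ψ y : E4) =
      E4.ofTimeSpace (bentHeight M a (Kerr.radius a (E4.ofTimeSpace 0 (y : E3)))) (y : E3))
    {y : Kerr.slice a r₁} (hy : Kerr.radius a (E4.ofTimeSpace 0 (y : E3)) < 4 * M) (v : E3) :
    mfderiv 𝓘(ℝ, E3) 𝓘(ℝ, E4) ψ y v = E4.ofTimeSpace 0 v := by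
  rw [(psi_eventuallyEq_sliceEmbed hM0 hψ hy).mfderiv_eq, Kerr.mfderiv_sliceEmbed]
  rfl

variable [Kerr.Facts] {ν : NormalField 𝓘(ℝ, E4) ψ}

/-- **Below `4M` the future unit normal of the bent graph IS the slice normal `Kerr.sliceNormal`**
(`eq_sliceNormalRep_of_normal`). O'Neill 1983, Ch. 5, Lemma 5.26. [cite: Cook2000, §3.2.2] -/
theorem nu_eq_sliceNormal (hM : 0 ≤ M) (hM0 : 0 < M)
    (hψ : ∀ y : Kerr.slice a r₁, (ψ y : E4) =
      E4.ofTimeSpace (bentHeight M a (Kerr.radius a (E4.ofTimeSpace 0 (y : E3)))) (y : E3))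
    (hν : (Kerr.smoothMetric M a r₁).IsFutureUnitNormal 𝓘(ℝ, E3)
      ((Kerr.timeOrientation M a r₁ hM).ofLE le_top) ψ ν)
    {y : Kerr.slice a r₁} (hy : Kerr.radius a (E4.ofTimeSpace 0 (y : E3)) < 4 * M) :
    ν y = Kerr.sliceNormal M a r₁ y := by
  have hr : 0 < Kerr.radius a (E4.ofTimeSpace 0 (y : E3)) :=
    Kerr.radius_pos_of_mem_region (Kerr.mem_slice_iff_ofTimeSpace_mem_region.1 y.2)
  have hψy : (ψ y : E4) = E4.ofTimeSpace 0 y := by rw [psi_eq_sliceEmbed hM0 hψ hy, Kerr.coe_sliceEmbed]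
  have h1 : ∀ w : E3, Kerr.bilin M a (E4.ofTimeSpace 0 y) (ν y) (E4.ofTimeSpace 0 w) = 0 := by
    intro w
    have h := hν.1.1 y w
    rw [mfderiv_psi hM0 hψ hy] at h
    have h' : Kerr.bilin M a (ψ y : E4) (ν y) (E4.ofTimeSpace 0 w) = 0 := h
    rwa [hψy] at h'
  have h2 : Kerr.bilin M a (E4.ofTimeSpace 0 y) (ν y) (ν y) = -1 := by
    have h' : Kerr.bilin M a (ψ y : E4) (ν y) (ν y) = -1 := hν.1.2 y
    rwa [hψy] at h'
  have h3 : Kerr.bilin M a (E4.ofTimeSpace 0 y) (Kerr.timeVector M a (E4.ofTimeSpace 0 y)) (ν y) < 0 := by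
    have h := (hν.2 y).2
    rw [TimeOrientation.vectorField_ofLE] at h
    have h' : Kerr.bilin M a (ψ y : E4) (Kerr.timeVector M a (ψ y : E4)) (ν y) < 0 := h
    rwa [hψy] at h'
  rw [Kerr.sliceNormal_apply]
  exact eq_sliceNormalRep_of_normal hM hr h1 h2 h3

/-- **Below `4M` the second fundamental form of the bent graph w.r.t. its future unit normal IS
that of the Kerr–Schild slice w.r.t. `Kerr.sliceNormal`**: both (map, normal) pairs have
representatives agreeing NEAR `y` (`bentRep_eventuallyEq`, `nu_eq_sliceNormal`), hence to first
order at `y`, which is all `OpensChart.secondFundamentalForm_eq_of_repr` consumes. O'Neill 1983,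
Ch. 4, Lemma 4.1/4.4; Wald 1984, (10.2.13). [cite: ONeill1983, Ch. 4, Lemma 4.4] -/
theorem secondFundamentalForm_eq_slice (hM : 0 ≤ M) (hM0 : 0 < M)
    [(Kerr.smoothMetric M a r₁).HasLeviCivita]
    (hψ : ∀ y : Kerr.slice a r₁, (ψ y : E4) =
      E4.ofTimeSpace (bentHeight M a (Kerr.radius a (E4.ofTimeSpace 0 (y : E3)))) (y : E3))
    (hν : (Kerr.smoothMetric M a r₁).IsFutureUnitNormal 𝓘(ℝ, E3)
      ((Kerr.timeOrientation M a r₁ hM).ofLE le_top) ψ ν)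
    {y : Kerr.slice a r₁} (hy : Kerr.radius a (E4.ofTimeSpace 0 (y : E3)) < 4 * M) (v w : E3) :
    (Kerr.smoothMetric M a r₁).secondFundamentalForm 𝓘(ℝ, E3) ψ ν y v w =
      (Kerr.smoothMetric M a r₁).secondFundamentalForm 𝓘(ℝ, E3) (Kerr.sliceEmbed a r₁)
        (Kerr.sliceNormal M a r₁) y v w := by
  classical
  have hr : 0 < Kerr.radius a (E4.ofTimeSpace 0 (y : E3)) :=
    Kerr.radius_pos_of_mem_region (Kerr.mem_slice_iff_ofTimeSpace_mem_region.1 y.2)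
  -- representatives of `ψ` and of the slice embedding
  set Φ : E3 → E4 := fun u ↦ E4.ofTimeSpace (bentHeight M a (Kerr.radius a (E4.ofTimeSpace 0 u))) u
  have hψΦ : ∀ z : Kerr.slice a r₁, (ψ z : E4) = Φ z := fun z ↦ hψ z
  have hrep : Φ =ᶠ[𝓝 (y : E3)] E4.ofTimeSpace 0 := bentRep_eventuallyEq hM0 hy
  have hΦ₀d : DifferentiableAt ℝ (E4.ofTimeSpace 0) (y : E3) :=
    (E4.hasFDerivAt_ofTimeSpace 0 _).differentiableAt
  have hΦd : DifferentiableAt ℝ Φ y := hΦ₀d.congr_of_eventuallyEq hrep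
  have hΦ' : fderiv ℝ Φ y = fderiv ℝ (E4.ofTimeSpace 0) y := hrep.fderiv_eq
  -- representatives of `ν` and of the slice normal
  set Nrep : E3 → E4 := fun u ↦ (√(1 + 2 * Kerr.scalarH M a (E4.ofTimeSpace 0 u)))⁻¹ •
    Kerr.timeVector M a (E4.ofTimeSpace 0 u)
  have hN₀ : ∀ z : Kerr.slice a r₁, Kerr.sliceNormal M a r₁ z = Nrep z := fun z ↦ rfl
  set N : E3 → E4 := fun u ↦ if hu : u ∈ Kerr.slice a r₁ then (ν ⟨u, hu⟩ : E4) else 0 with hNdef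
  have hνN : ∀ z : Kerr.slice a r₁, ν z = N z := fun z ↦ by simp only [hNdef, dif_pos z.2]
  have hNloc : N =ᶠ[𝓝 (y : E3)] Nrep := by
    have ho : IsOpen {u : E3 | u ∈ Kerr.slice a r₁ ∧ Kerr.radius a (E4.ofTimeSpace 0 u) < 4 * M} :=
      (Kerr.slice a r₁).isOpen.inter (isOpen_lt (continuous_radius_ofTimeSpace a) continuous_const)
    filter_upwards [ho.mem_nhds ⟨y.2, hy⟩] with u hu
    simp only [hNdef, dif_pos hu.1]
    exact nu_eq_sliceNormal hM hM0 hψ hν (y := ⟨u, hu.1⟩) hu.2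
  have hN₀d : DifferentiableAt ℝ Nrep y :=
    (Kerr.contDiffAt_sliceNormalRep hM a hr (n := 1)).differentiableAt one_ne_zero
  have hNd : DifferentiableAt ℝ N y := hN₀d.congr_of_eventuallyEq hNloc
  rw [OpensChart.secondFundamentalForm_eq_of_repr
      (g := (Kerr.smoothMetric M a r₁).toPseudoRiemannianMetric) (G := Kerr.bilin M a)
      (Kerr.smoothMetric_val M a r₁) hψΦ hνN hΦd hNd (Kerr.differentiableAt_bilin M a _) v w,
    OpensChart.secondFundamentalForm_eq_of_repr
      (g := (Kerr.smoothMetric M a r₁).toPseudoRiemannianMetric) (G := Kerr.bilin M a)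
      (Kerr.smoothMetric_val M a r₁) (Kerr.coe_sliceEmbed a r₁) hN₀ hΦ₀d hN₀d
      (Kerr.differentiableAt_bilin M a _) v w,
    hNloc.fderiv_eq, hNloc.self_of_nhds, hΦ', psi_eq_sliceEmbed hM0 hψ hy]

end Unbent

end SoftOfExactShield

open SoftOfExactShield

/-- **Stub 1b of line `Sketch` (crux `CaptureSufficesC2`, stmt-FinalStateConjecture-14986; v5, size M,
TRUE bookkeeping): EXACT shields at the mass junction are ε-SOFT C2 shields** for every `(s, δ)`,
`ε > 0` (registered signature, verbatim), with the same witnesses `(φ, ψ, ν)`: on the open collar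
`{M < r < 4M}`, `ψ = Kerr.sliceEmbed` and (uniqueness of the future unit normal) `ν = Kerr.sliceNormal`
near every point, so by locality the differences `(φ^* D).hFun − (Kerr.data M a M).hFun`,
`(φ^* D).kFun − (Kerr.data M a M).kFun` VANISH there and all collar seminorms are `0` (clauses (i),
(iii)); clauses (ii) are the hypothesis. Cook 2000, §3.2.2; O'Neill 1983, Ch. 4–5;
Dafermos–Rodnianski arXiv:0811.0354, §5.1. [cite: arXiv08110354, §5.1] -/
theorem stub_softOfExactShield :
    ∀ [Kerr.Facts] [Kerr.SliceFacts] (s : ℕ) (δ ε M a : ℝ), 0 < ε → 0 < M →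
      ∀ (X : Type) [TopologicalSpace X] [ChartedSpace E3 X] [IsManifold (𝓡 3) ∞ X]
        (D : InitialDataSet (𝓡 3) X),
        (∃ (hM : 0 ≤ M) (φ : Kerr.slice a M → X) (_hφ : ContMDiff 𝓘(ℝ, E3) (𝓡 3) (∞ + 1) φ)
                    (_hφ' : ∀ u, Function.Injective (mfderiv 𝓘(ℝ, E3) (𝓡 3) φ u))
                    (ψ : Kerr.slice a M → Kerr.region a M) (ν : NormalField 𝓘(ℝ, E4) ψ),
                    |a| < M ∧ IsCompact (Set.range φ)ᶜ ∧ Topology.IsOpenEmbedding φ ∧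
                    (∀ R : ℝ, IsCompact (φ '' {y : Kerr.slice a M | R < Kerr.radius a (E4.ofTimeSpace 0 (y : E3))})ᶜ) ∧
                    (∀ y : Kerr.slice a M, (ψ y : E4) =
                      E4.ofTimeSpace (bentHeight M a (Kerr.radius a (E4.ofTimeSpace 0 (y : E3)))) (y : E3)) ∧
                    (Kerr.smoothMetric M a M).IsSpacelikeImmersion 𝓘(ℝ, E3) ψ ∧
                    (Kerr.smoothMetric M a M).IsFutureUnitNormal 𝓘(ℝ, E3)
                      ((Kerr.timeOrientation M a M hM).ofLE le_top) ψ ν ∧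
                    (∀ y : Kerr.slice a M,
                      pullbackBilin (I := 𝓡 3) (I' := 𝓘(ℝ, E3)) φ D.h.inner y =
                        pullbackBilin (I := 𝓘(ℝ, E4)) (I' := 𝓘(ℝ, E3)) ψ (Kerr.smoothMetric M a M).val y) ∧
                    (∀ [(Kerr.smoothMetric M a M).HasLeviCivita] (y : Kerr.slice a M),
                      (pullbackBilin (I := 𝓡 3) (I' := 𝓘(ℝ, E3)) φ D.k y).toLinearMap₁₂ =
                        (Kerr.smoothMetric M a M).secondFundamentalForm 𝓘(ℝ, E3) ψ ν y)) →
                  (∃ (hM : 0 ≤ M) (φ : Kerr.slice a M → X) (hφ : ContMDiff 𝓘(ℝ, E3) (𝓡 3) (∞ + 1) φ)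
                    (hφ' : ∀ u, Function.Injective (mfderiv 𝓘(ℝ, E3) (𝓡 3) φ u))
                    (ψ : Kerr.slice a M → Kerr.region a M) (ν : NormalField 𝓘(ℝ, E4) ψ),
                    |a| < M ∧ IsCompact (Set.range φ)ᶜ ∧ Topology.IsOpenEmbedding φ ∧
                    (∀ R : ℝ, IsCompact (φ '' {y : Kerr.slice a M | R < Kerr.radius a (E4.ofTimeSpace 0 (y : E3))})ᶜ) ∧
                    weightedSobolevSeminorm
                        {y : E3 | M < Kerr.radius a (E4.ofTimeSpace 0 y) ∧
                          Kerr.radius a (E4.ofTimeSpace 0 y) < 4 * M} s δ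
                        ((D.comap φ hφ hφ').hFun - (Kerr.data M a M hM).hFun) +
                      weightedSobolevSeminorm
                        {y : E3 | M < Kerr.radius a (E4.ofTimeSpace 0 y) ∧
                          Kerr.radius a (E4.ofTimeSpace 0 y) < 4 * M}
                        (s - 1) (δ + 1) ((D.comap φ hφ hφ').kFun - (Kerr.data M a M hM).kFun) <
                      ENNReal.ofReal ε ∧
                    (∀ s' : ℕ, weightedSobolevSeminorm
                        {y : E3 | M < Kerr.radius a (E4.ofTimeSpace 0 y) ∧
                          Kerr.radius a (E4.ofTimeSpace 0 y) < 4 * M} s' δ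
                        ((D.comap φ hφ hφ').hFun - (Kerr.data M a M hM).hFun) +
                      weightedSobolevSeminorm
                        {y : E3 | M < Kerr.radius a (E4.ofTimeSpace 0 y) ∧
                          Kerr.radius a (E4.ofTimeSpace 0 y) < 4 * M}
                        (s' - 1) (δ + 1) ((D.comap φ hφ hφ').kFun - (Kerr.data M a M hM).kFun) < ⊤) ∧
                    (∀ y : Kerr.slice a M, (ψ y : E4) =
                      E4.ofTimeSpace (bentHeight M a (Kerr.radius a (E4.ofTimeSpace 0 (y : E3)))) (y : E3)) ∧
                    (Kerr.smoothMetric M a M).IsSpacelikeImmersion 𝓘(ℝ, E3) ψ ∧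
                    (Kerr.smoothMetric M a M).IsFutureUnitNormal 𝓘(ℝ, E3)
                      ((Kerr.timeOrientation M a M hM).ofLE le_top) ψ ν ∧
                    (∀ y : Kerr.slice a M, 3 * M ≤ Kerr.radius a (E4.ofTimeSpace 0 (y : E3)) →
                      pullbackBilin (I := 𝓡 3) (I' := 𝓘(ℝ, E3)) φ D.h.inner y =
                        pullbackBilin (I := 𝓘(ℝ, E4)) (I' := 𝓘(ℝ, E3)) ψ (Kerr.smoothMetric M a M).val y) ∧
                    (∀ [(Kerr.smoothMetric M a M).HasLeviCivita] (y : Kerr.slice a M),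
                      3 * M ≤ Kerr.radius a (E4.ofTimeSpace 0 (y : E3)) →
                      (pullbackBilin (I := 𝓡 3) (I' := 𝓘(ℝ, E3)) φ D.k y).toLinearMap₁₂ =
                        (Kerr.smoothMetric M a M).secondFundamentalForm 𝓘(ℝ, E3) ψ ν y)) := by
  intro _ _ s δ ε M a hε hM0 X _ _ _ D hex
  obtain ⟨hM, φ, hφ, hφ', ψ, ν, ha, hcpt, hemb, hcap, hψ, hspace, hnormal, hh, hk⟩ := hex
  -- the open collar and its points
  set U : Set E3 := {y : E3 | M < Kerr.radius a (E4.ofTimeSpace 0 y) ∧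
    Kerr.radius a (E4.ofTimeSpace 0 y) < 4 * M} with hUdef
  have hUo : IsOpen U := (isOpen_lt continuous_const (continuous_radius_ofTimeSpace a)).inter
    (isOpen_lt (continuous_radius_ofTimeSpace a) continuous_const)
  have hUS : ∀ z ∈ U, z ∈ Kerr.slice a M := fun z hz ↦ Kerr.mem_slice.2 (max_lt hz.1 (hM0.trans hz.1))
  -- (h): the pulled-back metric IS the slice metric on the collar
  have hfh : EqOn ((D.comap φ hφ hφ').hFun - (Kerr.data M a M hM).hFun) 0 U := by
    intro z hz
    have hzS := hUS z hz
    rw [Pi.sub_apply, Pi.zero_apply]; refine (sub_eq_zero (G := E3 →L[ℝ] E3 →L[ℝ] ℝ)).mpr ?_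
    rw [InitialDataSet.hFun_of_mem _ hzS, InitialDataSet.hFun_of_mem _ hzS]
    ext v w
    have e := DFunLike.congr_fun (DFunLike.congr_fun (hh ⟨z, hzS⟩) v) w
    rw [pullbackBilin_apply, pullbackBilin_apply, mfderiv_psi hM0 hψ (y := ⟨z, hzS⟩) hz.2,
      mfderiv_psi hM0 hψ (y := ⟨z, hzS⟩) hz.2, Kerr.smoothMetric_val,
      psi_eq_sliceEmbed hM0 hψ (y := ⟨z, hzS⟩) hz.2, Kerr.coe_sliceEmbed] at e
    rw [InitialDataSet.comap_h_inner, Kerr.data_h_inner, PseudoRiemannianMetric.inducedBilin_apply,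
      Kerr.mfderiv_sliceEmbed, Kerr.smoothMetric_val, Kerr.coe_sliceEmbed]
    exact e
  -- (k): the pulled-back `k` IS the slice second fundamental form on the collar
  have hfk : EqOn ((D.comap φ hφ hφ').kFun - (Kerr.data M a M hM).kFun) 0 U := by
    intro z hz
    have hzS := hUS z hz
    rw [Pi.sub_apply, Pi.zero_apply]; refine (sub_eq_zero (G := E3 →L[ℝ] E3 →L[ℝ] ℝ)).mpr ?_
    rw [InitialDataSet.kFun_of_mem _ hzS, InitialDataSet.kFun_of_mem _ hzS]
    ext v w
    have e := LinearMap.congr_fun₂ (hk ⟨z, hzS⟩) v w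
    rw [ContinuousLinearMap.toLinearMap₁₂_apply, pullbackBilin_apply,
      secondFundamentalForm_eq_slice hM hM0 hψ hnormal (y := ⟨z, hzS⟩) hz.2 v w] at e
    rw [InitialDataSet.comap_k, Kerr.data_k, Kerr.sliceK_apply]
    exact e
  obtain ⟨h1, h3⟩ := collar_clauses_of_eqOn_zero (G := E3 →L[ℝ] E3 →L[ℝ] ℝ) hUo hfh hfk hε s δ
  exact ⟨hM, φ, hφ, hφ', ψ, ν, ha, hcpt, hemb, hcap, h1, h3, hψ, hspace, hnormal,
    fun y _ ↦ hh y, fun y _ ↦ hk y⟩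

end Summit.FinalStateConjecture.FinalStateConjecture.Theorems.CaptureSufficesC2.Sketch

end
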